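import Summits.BirchSwinnertonDyer.BirchSwinnertonDyer.Theorems.KimAtThreeDeepUpperBadPlaceCondition
import Summits.BirchSwinnertonDyer.Rank1Residual.GaloisImage.KolyvaginSystemOfEulerSystemPairBad
import Summits.BirchSwinnertonDyer.Rank1Residual.GaloisImage.KolyvaginTransverseRatLocal
import HarnessLib

/-!
# THEOREM D's local clause at an ANOMALOUS bad place WITHOUT prime thinning — the `_of_unramified`
# twin of T-DER-D4BN F1 on Kato's cyclotomic levels (cell `bsd-addord`, seat w2-c3 gen 5; route W2
# `KimAtThreeKolyvagin`, crux 19076 `DeepUpperAtThree`, §U child 19560, residual (C3))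

HONEST FRAMING: TOOL theorems (no definition, no named fact, no `sorry`); closes nothing by itself;
nothing is booked; BSD is not proved by any of this.

## What

n1011-p15's T-DER-D4BN F1
`Derivative.Rat.localization_mem_propagatedSelmerStructure_of_res_eq_deriv_of_forall_not_dvd_orderOf`
(`KolyvaginSystemOfEulerSystemBadPlaces`) reads, at a finite place `w ∉ r`:
`loc_w (Φ κ) ∈ propagatedSelmerStructure W p k (inr w)` PROVIDED `p ∤ ord(w mod q)` for every `q ∈ r`
(the prime set `𝒫″`).  **`localization_mem_propagatedSelmerStructure_of_res_eq_deriv_of_unramified`**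
is the same conclusion with that thinning hypothesis REPLACED by: the family `c` IS an Euler system
(`hc`), the Kolyvagin-prime data of THEOREM A at the level `r` (Frobenii `Fr`, `hσ`/`hcov`/`hinj`,
`hFr`, `hram`, and `T′` killed by `ℓ − 1` and by `P_ℓ(1)`, `(T′)^{U_r} = 0`), and the (C2)-type
unramifiedness of the classes `c_{⊥,s}`, `s ⊆ r`, above `w` — the `H¹(ℤ[ζ_m, 1/p], T)` clause of
Kato (8.1.3), VERBATIM the conjunct (C2) of the tree's `ZetaBody` at the tame levels.  It is the seat's
`KimAtThreeDeepUpperBadPlaceCondition.localization_mem_propagatedSelmerStructure_three_of_unramified`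
(THEOREM B-u + U4 + stable range) read on `cyclotomicLevelsRat p S`, whose levels are unramified at
`w ∉ r` (`Derivative.Rat.subgroupIsUnramifiedAt_level_bot`).  §1 packages the Kolyvagin-prime
arithmetic that feeds it from `Kato.IsKolyvaginPrime` (`hM₁`: `ℓ − 1 ∈ p^{k+1}ℤ_p`; `hM₂`:
`P_ℓ(1) ∈ p^{k+1}ℤ_p`; `hram`; `h0` in `T′`-currency).

HONEST LIMITS: **`p = 3` only** in §2 (the statement is written at `3`): the level-`k` stable range
`im(H¹(ℚ_w, E[p^m·p]) → H¹(ℚ_w, E[p^k·p])) = 𝓕_can` is typed in the tree at `p = 3`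
(`PropagatedConditionStableRangeThree`); a general-`p` twin of that file gives the general-`p` statement verbatim.
Nothing at the place `p` itself.

References: B. Mazur, K. Rubin, Mem. AMS 799 (2004), Def. 3.2.1, Thm. 3.2.4, App. A Prop. A.2 and
Remark A.5; K. Rubin, *Euler Systems* (2000), Lemma 4.4.2, Thm. 4.5.1; K. Kato, Astérisque 295 (2004),
(8.1.3), §8.2, Lemma 8.5.
-/

noncomputable section

-- the cell's Theorems namespace `Summit.BirchSwinnertonDyer.BirchSwinnertonDyer.…` repeats the summit name by design (D-0017)
set_option linter.dupNamespace false

open CategoryTheory Function Finset Polynomial Field IsDedekindDomain NumberField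
open scoped NumberField Classical ContRepresentation
open Literature.NumberTheory.GaloisRepresentations Literature.NumberTheory.EllipticCurves
open Literature.NumberTheory.GaloisRepresentations.DiscreteGaloisModule
open Literature.NumberTheory.GaloisCohomology
open Summit.BirchSwinnertonDyer.Rank1Residual.GaloisImage
open Summit.BirchSwinnertonDyer.Rank1Residual.GaloisImage.CoeffTransport
open Summit.BirchSwinnertonDyer.Rank1Residual.GaloisImage.CyclotomicLevel
open Summit.BirchSwinnertonDyer.Rank1Residual.GaloisImage.Derivative
open Summit.BirchSwinnertonDyer.Rank1Residual.GaloisImage.Derivative.Transverse.Rat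
open Summit.BirchSwinnertonDyer.BirchSwinnertonDyer.Theorems.KimAtThreeDeepUpperBadPlaceCondition
open Rat.HeightOneSpectrum WeierstrassCurve

namespace Summit.BirchSwinnertonDyer.BirchSwinnertonDyer.Theorems.KimAtThreeDeepUpperBadPlaceClause

section General

variable (W : WeierstrassCurve ℚ) [W.IsElliptic] [W.IsGloballyMinimal] (p : ℕ) [Fact p.Prime] (k : ℕ)
variable [Module.Free ℤ_[p] (W.tateModule p)] [Module.Finite ℤ_[p] (W.tateModule p)]
  [ContinuousSMul ℤ_[p] (W.tateModule p)]

/-- Local notation: `T∞ = T_p E` as a continuous `Γ_ℚ`-representation. -/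
local notation3 "T∞" => WeierstrassCurve.tateGaloisRep W p (W.continuous_galoisRepTate_holds p)

variable (S : Set (HeightOneSpectrum (𝓞 ℚ)))

/-- Local notation: `𝓛` = the cyclotomic Euler-system levels `ℚ(μ_{p^{n+1}}, μ_r)`, `r ∩ S = ∅`. -/
local notation3 "𝓛" => cyclotomicLevelsRat p S

/-! ### §0 Restriction to an inertia group inside an unramified level -/

section ResZero

universe u v

variable {R : Type u} [CommRing R] [TopologicalSpace R]
variable {G : Type v} [Group G] [TopologicalSpace G] [IsTopologicalGroup G] (X : TopRep.{v} R G)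

/-- If the restriction of `y ∈ H¹(H, X)` to `H ⊓ I` vanishes then so does its restriction to any
`I ≤ H` (transitivity of restriction along `I ≤ H ⊓ I ≤ H`). [folklore] -/
theorem resLe_eq_zero_of_resLe_inf_eq_zero {H I : Subgroup G} (hIH : I ≤ H)
    (y : continuousCohomology 1 (subgroupRep X H))
    (h : resLe X (inf_le_left : H ⊓ I ≤ H) 1 y = 0) : resLe X hIH 1 y = 0 := by
  have e := resLe_resLe X (le_inf hIH le_rfl : I ≤ H ⊓ I) (inf_le_left : H ⊓ I ≤ H) y
  rw [h, _root_.map_zero] at e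
  exact e.symm

end ResZero

/-! ### §1 Kolyvagin-prime arithmetic feeding THEOREM B-u -/


omit [W.IsElliptic] [Module.Free ℤ_[p] (W.tateModule p)] [Module.Finite ℤ_[p] (W.tateModule p)]
  [ContinuousSMul ℤ_[p] (W.tateModule p)] in
/-- **`(ℓ − 1) · T′ = 0`** for a Kolyvagin prime `ℓ` of level `k + 1` (`p^{k+1} ∣ ℓ − 1`) and `T′`
killed by `p^{k+1}` (THEOREM B-u's `hM₁`). [folklore] -/
theorem natCast_sub_one_smul_eq_zero_of_isKolyvaginPrime
    {M' : Type*} [AddCommGroup M'] [Module ℤ_[p] M']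
    (hM : ∀ x : M', ((p : ℤ_[p]) ^ (k + 1)) • x = 0) {ℓ : ℕ}
    (hKol : Kato.IsKolyvaginPrime W p (k + 1) ℓ) (v : M') :
    ((ℓ - 1 : ℕ) : ℤ_[p]) • v = 0 := by
  obtain ⟨b, hb⟩ := exists_natCast_sub_one_eq_pow_mul (p := p) hKol.modEq_one
  rw [hb, mul_comm, mul_smul, hM, smul_zero]

omit [ContinuousSMul ℤ_[p] (W.tateModule p)] in
/-- **`P_ℓ(1) · T′ = 0`** for a Kolyvagin prime `ℓ` of level `k + 1` and an arithmetic Frobenius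
`Fr` at `ℓ`: Rubin's Euler factor of `T_pE` at `Fr` is `(X − 1)² + p^{k+1}·R`
(`exists_rubinEulerFactor_eq_sq_add`), so its value at `1` kills a `p^{k+1}`-torsion module
(THEOREM B-u's `hM₂`). [cite: Rubin2000, Def. 4.4.4 and Lemma 4.4.2] -/
theorem eval_one_rubinEulerFactor_smul_eq_zero_of_isKolyvaginPrime
    {M' : Type*} [AddCommGroup M'] [Module ℤ_[p] M']
    (hM : ∀ x : M', ((p : ℤ_[p]) ^ (k + 1)) • x = 0) {ℓ : HeightOneSpectrum (𝓞 ℚ)}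
    (hKol : Kato.IsKolyvaginPrime W p (k + 1) ((primesEquiv ℓ : Nat.Primes) : ℕ))
    {Fr : absoluteGaloisGroup ℚ} (hFr : IsArithFrobAtPlace ℚ ℓ Fr) (v : M') :
    (rubinEulerFactor (T∞).toRepresentation (cyclotomicCharacterToUnits ℚ p ℤ_[p]) Fr).eval 1 • v = 0 := by
  obtain ⟨R, hR⟩ := exists_rubinEulerFactor_eq_sq_add W hKol hFr
  have h : (rubinEulerFactor (T∞).toRepresentation (cyclotomicCharacterToUnits ℚ p ℤ_[p]) Fr).eval 1 =
      ((p : ℤ_[p]) ^ (k + 1)) * R.eval 1 := by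
    change (rubinEulerFactor (W.galoisRepTate p) (cyclotomicCharacterToUnits ℚ p ℤ_[p]) Fr).eval 1 = _
    rw [hR]
    simp
  rw [h, mul_comm, mul_smul, hM, smul_zero]

omit [W.IsElliptic] [W.IsGloballyMinimal] [Module.Free ℤ_[p] (W.tateModule p)]
  [Module.Finite ℤ_[p] (W.tateModule p)] [ContinuousSMul ℤ_[p] (W.tateModule p)] in
/-- **`h0` in `T′`-currency**: if `E[p^k·p]` has no non-zero point fixed by the level `U`, neither has
`T′ ≅ E[p^k·p]` (transport along `e`/`einv`). [folklore] -/
theorem eq_zero_of_forall_level_fixed_of_equiv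
    {M' : Type} [AddCommGroup M'] [Module ℤ_[p] M'] [TopologicalSpace M']
    [IsTopologicalAddGroup M'] [ContinuousSMul ℤ_[p] M'] {T' : GaloisRep ℚ ℤ_[p] M'}
    (e : M' →+ WeierstrassCurve.geomTorsion W ((p : ℤ) ^ k * (p : ℤ)))
    (he : ∀ (g : absoluteGaloisGroup ℚ) (x : M'),
      e (T'.toTopRep.ρ g x) = (W.torsionGaloisModule ((p : ℤ) ^ k * (p : ℤ))).toTopRep.ρ g (e x))
    (einv : WeierstrassCurve.geomTorsion W ((p : ℤ) ^ k * (p : ℤ)) →+ M') (h₁ : ∀ x, einv (e x) = x)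
    (U : Subgroup (absoluteGaloisGroup ℚ))
    (h0 : ∀ P : WeierstrassCurve.geomTorsion W ((p : ℤ) ^ k * (p : ℤ)),
      (∀ u : U, (u : absoluteGaloisGroup ℚ) • P = P) → P = 0)
    (v : T'.toTopRep) (hv : ∀ u : U, T'.toTopRep.ρ (u : absoluteGaloisGroup ℚ) v = v) : v = 0 := by
  have h := h0 (e v) fun u => by
    have := congrArg e (hv u)
    rw [he] at this
    exact this
  have := congrArg einv h
  rwa [h₁, _root_.map_zero] at this

end General

/-! ### §2 The local clause WITHOUT thinning -/

section Three

variable (W : WeierstrassCurve ℚ) [W.IsElliptic] [W.IsGloballyMinimal] (k : ℕ) [Fact (Nat.Prime 3)]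
variable [Module.Free ℤ_[3] (W.tateModule 3)] [Module.Finite ℤ_[3] (W.tateModule 3)]
  [ContinuousSMul ℤ_[3] (W.tateModule 3)]

/-- Local notation: `T₃ = T₃ E` as a continuous `Γ_ℚ`-representation. -/
local notation3 "T₃" => WeierstrassCurve.tateGaloisRep W 3 (W.continuous_galoisRepTate_holds 3)

variable {S : Set (HeightOneSpectrum (𝓞 ℚ))}

/-- Local notation: `𝓛₃` = Kato's cyclotomic levels `ℚ(μ_{3^{n+1}}, μ_r)`, `r ∩ S = ∅`. -/
local notation3 "𝓛₃" => cyclotomicLevelsRat 3 S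

variable {M' : Type} [AddCommGroup M'] [Module ℤ_[3] M'] [TopologicalSpace M']
  [IsTopologicalAddGroup M'] [ContinuousSMul ℤ_[3] M'] {T' : GaloisRep ℚ ℤ_[3] M'}

omit [W.IsGloballyMinimal] in
/-- **THEOREM D's local clause at a place `w ∉ r ∪ {p}` — bad `w` with `E(ℚ_w)[p] ≠ 0` INCLUDED —
with NO condition on the primes of `r`** (T-DER-D4BN F1's binders with `hord` REPLACED by the
Euler-system axioms `hc`, THEOREM A's Kolyvagin-prime data at `r`, and the unramifiedness `hur` of the
classes `c_{⊥,s}`, `s ⊆ r`, above `w` = `ZetaBody` (C2) at the tame levels): for `red : T_pE ⟶ T′`,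
`e : T′ → E[p^k·p]` additive continuous equivariant with `π_{k+1} = e ∘ red`, `Φ` computed on
cocycles by `e`, and `κ` with `res_{U_r} κ = D_r (red_* c_{⊥,r})`:
`loc_w (Φ κ) ∈ propagatedSelmerStructure W 3 k (Sum.inr w)`.  `p = 3` (module docstring).
[cite: MazurRubin2004, Def. 3.2.1, Thm. 3.2.4 and App. A Remark A.5 (p. 81)]
[cite: Rubin2000, Lemma 4.4.2 and Thm. 4.5.1] [cite: Kato2004Asterisque, (8.1.3) (p. 180) and Lemma 8.5] -/
theorem localization_mem_propagatedSelmerStructure_of_res_eq_deriv_of_unramified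
    {c : ∀ (i : ℕ) (r : (𝓛₃).Ideals), H1 T₃ ((𝓛₃).level i r.1)} (hc : IsEulerSystem 𝓛₃ T₃ 3 c)
    (red : (T₃).toTopRep ⟶ T'.toTopRep)
    (e : M' →+ WeierstrassCurve.geomTorsion W (((3 : ℕ) : ℤ) ^ k * ((3 : ℕ) : ℤ))) (hec : Continuous e)
    (he : ∀ (g : absoluteGaloisGroup ℚ) (x : M'),
      e (T' g x) = W.torsionGaloisModule (((3 : ℕ) : ℤ) ^ k * ((3 : ℕ) : ℤ)) g (e x))
    (hcomp : ∀ a : W.tateModule 3, tateToTorsion W 3 k a = e (red.hom a))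
    (Φ : continuousCohomology 1 T'.toTopRep →+
      galoisCohomology (W.torsionGaloisModule (((3 : ℕ) : ℤ) ^ k * ((3 : ℕ) : ℤ))) 1)
    (hΦ : ∀ (φ : contOneCocycles T'.toTopRep)
      (ψ : contOneCocycles (W.torsionGaloisModule (((3 : ℕ) : ℤ) ^ k * ((3 : ℕ) : ℤ))).toTopRep),
      (∀ g, ψ.1 g = e (φ.1 g)) → Φ (oneCocycleClass _ φ) = oneCocycleClass _ ψ)
    (r : (𝓛₃).Ideals) (σ : HeightOneSpectrum (𝓞 ℚ) → absoluteGaloisGroup ℚ)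
    (Fr : HeightOneSpectrum (𝓞 ℚ) → absoluteGaloisGroup ℚ)
    (hσ : ∀ ℓ ∈ r.1, ∀ q ∈ r.1, q ≠ ℓ → σ ℓ ∈ (𝓛₃).tameLevel q)
    (hcov : ∀ ℓ ∈ r.1, ∀ g : absoluteGaloisGroup ℚ,
      ∃ j < ((primesEquiv ℓ : Nat.Primes) : ℕ) - 1, (σ ℓ ^ j)⁻¹ * g ∈ (𝓛₃).tameLevel ℓ)
    (hinj : ∀ ℓ ∈ r.1, ∀ j₁ < ((primesEquiv ℓ : Nat.Primes) : ℕ) - 1,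
      ∀ j₂ < ((primesEquiv ℓ : Nat.Primes) : ℕ) - 1, (σ ℓ ^ j₁)⁻¹ * σ ℓ ^ j₂ ∈ (𝓛₃).tameLevel ℓ → j₁ = j₂)
    (hFr : ∀ ℓ ∈ r.1, IsArithFrobAtPlace ℚ ℓ (Fr ℓ))
    (hram : ∀ ℓ ∈ r.1, ∀ s ⊆ r.1, ℓ ∉ s → ¬ SubgroupIsUnramifiedAt ℚ ((𝓛₃).level ⊥ (insert ℓ s)) ℓ)
    (hM₁ : ∀ ℓ ∈ r.1, ∀ v : M', ((((primesEquiv ℓ : Nat.Primes) : ℕ) - 1 : ℕ) : ℤ_[3]) • v = 0)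
    (hM₂ : ∀ ℓ ∈ r.1, ∀ v : M',
      (rubinEulerFactor (T₃).toRepresentation (cyclotomicCharacterToUnits ℚ 3 ℤ_[3]) (Fr ℓ)).eval 1 •
        v = 0)
    (comm)
    (h0 : ∀ v : T'.toTopRep,
      (∀ u : (𝓛₃).level ⊥ r.1, T'.toTopRep.ρ (u : absoluteGaloisGroup ℚ) v = v) → v = 0)
    (κ : continuousCohomology 1 T'.toTopRep)
    (hκ : resSubgroup T'.toTopRep ((𝓛₃).level ⊥ r.1) 1 κ =
        (r.1.noncommProd (fun ℓ => ∑ j ∈ range (((primesEquiv ℓ : Nat.Primes) : ℕ) - 1),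
          (j : Module.End ℤ_[3] (continuousCohomology 1 (subgroupRep T'.toTopRep ((𝓛₃).level ⊥ r.1)))) *
          (conjMap T'.toTopRep ((𝓛₃).level ⊥ r.1) (σ ℓ) 1).hom.toLinearMap ^ j) comm)
        (ContinuousCohomology.map (ContinuousMonoidHom.id _)
          (X := subgroupRep (T₃).toTopRep ((𝓛₃).level ⊥ r.1))
          (Y := subgroupRep T'.toTopRep ((𝓛₃).level ⊥ r.1))
          ((TopRep.resFunctor ((𝓛₃).level ⊥ r.1).subtype).map red) 1 (c ⊥ r)))
    (w : HeightOneSpectrum (𝓞 ℚ)) (hw : w ∉ r.1)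
    (hur : ∀ (s : Finset (HeightOneSpectrum (𝓞 ℚ))) (hs : s ⊆ r.1)
      (𝔓 : Ideal (absIntegers (𝓞 ℚ) ℚ)), 𝔓 ∈ w.primesAbove →
      resLe (T₃).toTopRep
        (inf_le_left : (𝓛₃).level ⊥ s ⊓ 𝔓.inertia (absoluteGaloisGroup ℚ) ≤ (𝓛₃).level ⊥ s) 1
        (c ⊥ ⟨s, fun q hq => r.2 q (hs hq)⟩) = 0) :
    galoisCohomology.localization (W.torsionGaloisModule (((3 : ℕ) : ℤ) ^ k * ((3 : ℕ) : ℤ))) (Sum.inr w) 1 (Φ κ) ∈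
      propagatedSelmerStructure W 3 k (Sum.inr w) := by
  -- the level is unramified at `w ∉ r`
  have hwU : SubgroupIsUnramifiedAt ℚ ((cyclotomicLevelsRat 3 S).level ⊥ r.1) w :=
    Derivative.Rat.subgroupIsUnramifiedAt_level_bot 3 S r.1 hw
  -- THEOREM B-u + U4 + stable range; (C2) at the sub-levels `s ⊆ r` in THEOREM B-u's form
  refine localization_mem_propagatedSelmerStructure_three_of_unramified W hc red k e hec he hcomp Φ hΦ r
    σ (fun ℓ => ((primesEquiv ℓ : Nat.Primes) : ℕ) - 1) Fr hσ hcov hinj hFr hram hM₁ hM₂ comm h0 κ hκ w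
    hwU fun s hs 𝔓 h𝔓 => ?_
  rw [resLe_resLe]
  exact resLe_eq_zero_of_resLe_inf_eq_zero (T₃).toTopRep _ _ (hur s hs 𝔓 h𝔓)

end Three

end Summit.BirchSwinnertonDyer.BirchSwinnertonDyer.Theorems.KimAtThreeDeepUpperBadPlaceClause

end
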